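import Mathlib
import HarnessLib
import Summits.NavierStokesRegularity.NavierStokesRegularity.Theorems.PoloidalWindowDoorLrcModEntireRidgeWebRecurrentJets

/-!
# Item `LrcModEntire` (stmt-NavierStokesRegularity-20428) / crux `PoloidalWindowRigidity` (19708) — RECURRENCE CONTROLS ALL JETS, UNIFORMLY ON A TIME WINDOW
# (the time-uniform form of `…RidgeWebRecurrentJets`; offer (iii) of ns-poloidal-K2-p2 g15, gated on the LEAD's word)

Seat ns-poloidal-K2-p2 g15 (`--supports stmt-NavierStokesRegularity-19708 --as helper`).

* `jet_closeness_of_slab_closeness_window` — for every `C`, order `k`, window `[a, b] ⊂ (−∞, 0)`, radius `R`, `ε > 0` there are `N`, `η > 0` such that two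
  class-`C` profiles `η`-close on slab `N` have `k`-jets `ε`-close on `B̄_R` at EVERY time of `[a, b]`.  Proof: a finite `δ₀`-net of times + the per-time
  statement `…RidgeWebRecurrentJets.jet_closeness_of_slab_closeness` + the class-uniform time-Lipschitz bound of `k`-jets
  (`…SqueezeCycleExtremalElementExistsRegularity.exists_lipschitz_time_of_typeI`, KNSS).
* `recurrent_jets_window` — the returns of any uniformly recurrent pair `(U, Γ)` (recurrence clause of `…RidgeWebRecurrent` VERBATIM) are close WITH ALL
  SPATIAL JETS, uniformly for `t ∈ [a, b]`, `x ∈ B̄_R` (plus the `C⁰` slab clause and the branch clause).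

WHAT THIS IS NOT: not a claim about Navier–Stokes regularity — a support for the (Q4) research cell (bears_on LADDER-NS N0, item 20428 / crux 19708; both OPEN;
NS regularity NOT proved).
-/

noncomputable section

-- the summit and its single sub-problem share the name (CONVENTIONS §1), as in every Theorems file
set_option linter.dupNamespace false

namespace Summit.NavierStokesRegularity.NavierStokesRegularity.Theorems.PoloidalWindowDoorLrcModEntireRidgeWebRecurrentJetsWindow

open Set Function Filter Topology Metric
open scoped InnerProductSpace RealInnerProductSpace NNReal ContDiff
open Literature.Analysis Literature.Analysis.FluidPDE Literature.Analysis.UnboundedOperators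
open Summit.NavierStokesRegularity.NavierStokesRegularity.Theorems
open PoloidalWindowDoorPoloidalWindowRigidityHotHullCompactness PoloidalWindowDoorLrcModEntireRidgeWebRecurrent PoloidalWindowDoorLrcModEntireRidgeWebRecurrentJets

/-- **C⁰-closeness on a large slab forces Cᵏ-closeness of the slices on a ball, UNIFORMLY ON A TIME WINDOW.**  See the module docstring. -/
theorem jet_closeness_of_slab_closeness_window (C : ℝ) (k : ℕ) {a b : ℝ} (hab : a ≤ b) (hb : b < 0) (R ε : ℝ) (hε : 0 < ε) :
    ∃ (N : ℕ) (η : ℝ), 0 < η ∧ ∀ U V : ℝ → EuclideanSpace ℝ (Fin 3) → EuclideanSpace ℝ (Fin 3),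
      HasTypeITimeDecay C U → ContinuousOn (uncurry U) (Iio (0 : ℝ) ×ˢ univ) →
      (∀ s t : ℝ, s < t → t < 0 → ∀ x, U t x = heatExtension (U s) (t - s) x - oseenDuhamel 1 s U U t x) →
      (∀ t < 0, VectorCalculus.IsDivFree (U t)) →
      HasTypeITimeDecay C V → ContinuousOn (uncurry V) (Iio (0 : ℝ) ×ˢ univ) →
      (∀ s t : ℝ, s < t → t < 0 → ∀ x, V t x = heatExtension (V s) (t - s) x - oseenDuhamel 1 s V V t x) →
      (∀ t < 0, VectorCalculus.IsDivFree (V t)) →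
      (∀ s ∈ Icc (-((N : ℝ) + 2)) (-((N : ℝ) + 2)⁻¹), ∀ x ∈ closedBall (0 : EuclideanSpace ℝ (Fin 3)) ((N : ℝ) + 2), dist (U s x) (V s x) < η) →
      ∀ t ∈ Icc a b, ∀ x ∈ closedBall (0 : EuclideanSpace ℝ (Fin 3)) R, ‖iteratedFDeriv ℝ k (U t) x - iteratedFDeriv ℝ k (V t) x‖ < ε := by
  classical
  -- class-uniform time-Lipschitz bound of `k`-jets on the window `[a, b] ⊆ Ico ((a-1)+1) (b/2)`
  have hab' : a - 1 < b / 2 := by linarith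
  have hb2 : b / 2 < 0 := by linarith
  obtain ⟨L, hL0, hL⟩ := exists_lipschitz_time_of_typeI C k hab' hb2 one_pos
  have hwin : ∀ t ∈ Icc a b, t ∈ Ico (a - 1 + 1) (b / 2) := fun t ht => ⟨by linarith [ht.1], by linarith [ht.2]⟩
  -- the time net: `t_i = min (a + i δ₀) b`, `i ≤ m`
  set δ₀ : ℝ := ε / (3 * (L + 1)) with hδ₀
  have hδ₀pos : 0 < δ₀ := by positivity
  have hLδ : L * δ₀ ≤ ε / 3 := by
    rw [hδ₀, mul_div_assoc', div_le_div_iff₀ (by positivity) (by positivity)]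
    nlinarith [hε.le]
  obtain ⟨m, hm⟩ := exists_nat_ge ((b - a) / δ₀)
  set ti : ℕ → ℝ := fun i => min (a + i * δ₀) b with hti
  have hti_mem : ∀ i, ti i ∈ Icc a b := fun i => ⟨le_min (by nlinarith [hδ₀pos.le, (i.cast_nonneg : (0:ℝ) ≤ i)]) hab, min_le_right _ _⟩
  have hti_neg : ∀ i, ti i < 0 := fun i => lt_of_le_of_lt (hti_mem i).2 hb
  -- per-time data
  have hper : ∀ i : ℕ, ∃ (N : ℕ) (η : ℝ), 0 < η ∧ ∀ U V : ℝ → EuclideanSpace ℝ (Fin 3) → EuclideanSpace ℝ (Fin 3),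
      HasTypeITimeDecay C U → ContinuousOn (uncurry U) (Iio (0 : ℝ) ×ˢ univ) →
      (∀ s t : ℝ, s < t → t < 0 → ∀ x, U t x = heatExtension (U s) (t - s) x - oseenDuhamel 1 s U U t x) →
      (∀ t < 0, VectorCalculus.IsDivFree (U t)) →
      HasTypeITimeDecay C V → ContinuousOn (uncurry V) (Iio (0 : ℝ) ×ˢ univ) →
      (∀ s t : ℝ, s < t → t < 0 → ∀ x, V t x = heatExtension (V s) (t - s) x - oseenDuhamel 1 s V V t x) →
      (∀ t < 0, VectorCalculus.IsDivFree (V t)) →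
      (∀ s ∈ Icc (-((N : ℝ) + 2)) (-((N : ℝ) + 2)⁻¹), ∀ x ∈ closedBall (0 : EuclideanSpace ℝ (Fin 3)) ((N : ℝ) + 2), dist (U s x) (V s x) < η) →
      ∀ x ∈ closedBall (0 : EuclideanSpace ℝ (Fin 3)) R, ‖iteratedFDeriv ℝ k (U (ti i)) x - iteratedFDeriv ℝ k (V (ti i)) x‖ < ε / 3 :=
    fun i => jet_closeness_of_slab_closeness C k (hti_neg i) R (ε / 3) (by positivity)
  choose Ns ηs hηs hJs using hper
  -- finite aggregation over `i ≤ m`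
  set N : ℕ := (Finset.range (m + 1)).sup Ns with hN
  have hηpos : 0 < (Finset.range (m + 1)).inf' (by simp) ηs := by
    rw [Finset.lt_inf'_iff]
    intro i _; exact hηs i
  refine ⟨N, (Finset.range (m + 1)).inf' (by simp) ηs, hηpos, ?_⟩
  intro U V hU1 hU2 hU3 hU4 hV1 hV2 hV3 hV4 hclose t ht x hx
  -- choose the net point `i = ⌊(t - a)/δ₀⌋ ≤ m`
  obtain ⟨i, hi_le, hti_close⟩ : ∃ i : ℕ, i ≤ m ∧ |t - ti i| ≤ δ₀ := by
    refine ⟨⌊(t - a) / δ₀⌋₊, ?_, ?_⟩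
    · have h1 : ((⌊(t - a) / δ₀⌋₊ : ℕ) : ℝ) ≤ (t - a) / δ₀ := Nat.floor_le (div_nonneg (by linarith [ht.1]) hδ₀pos.le)
      have h2 : (t - a) / δ₀ ≤ (b - a) / δ₀ := div_le_div_of_nonneg_right (by linarith [ht.2]) hδ₀pos.le
      exact_mod_cast (h1.trans (h2.trans hm))
    · have h1 : ((⌊(t - a) / δ₀⌋₊ : ℕ) : ℝ) ≤ (t - a) / δ₀ := Nat.floor_le (div_nonneg (by linarith [ht.1]) hδ₀pos.le)
      have h2 : (t - a) / δ₀ < ((⌊(t - a) / δ₀⌋₊ : ℕ) : ℝ) + 1 := Nat.lt_floor_add_one _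
      have h1' : a + (⌊(t - a) / δ₀⌋₊ : ℝ) * δ₀ ≤ t := by
        have := mul_le_mul_of_nonneg_right h1 hδ₀pos.le
        rw [div_mul_cancel₀ _ hδ₀pos.ne'] at this; linarith
      have h2' : t < a + ((⌊(t - a) / δ₀⌋₊ : ℝ) + 1) * δ₀ := by
        have := mul_lt_mul_of_pos_right h2 hδ₀pos
        rw [div_mul_cancel₀ _ hδ₀pos.ne'] at this; linarith
      have hle : ti ⌊(t - a) / δ₀⌋₊ ≤ t := by
        show min (a + (⌊(t - a) / δ₀⌋₊ : ℝ) * δ₀) b ≤ t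
        exact (min_le_left _ _).trans h1'
      have hge : t - δ₀ ≤ ti ⌊(t - a) / δ₀⌋₊ := by
        show t - δ₀ ≤ min (a + (⌊(t - a) / δ₀⌋₊ : ℝ) * δ₀) b
        refine le_min ?_ (by linarith [ht.2])
        nlinarith
      rw [abs_le]; constructor <;> linarith
  have hiF : i ∈ Finset.range (m + 1) := Finset.mem_range.2 (Nat.lt_succ_of_le hi_le)
  have hNi : Ns i ≤ N := Finset.le_sup (f := Ns) hiF
  have hηi : (Finset.range (m + 1)).inf' (by simp) ηs ≤ ηs i := Finset.inf'_le _ hiF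
  -- the per-time estimate at the net point
  have hclose_i : ∀ s ∈ Icc (-((Ns i : ℝ) + 2)) (-((Ns i : ℝ) + 2)⁻¹), ∀ x ∈ closedBall (0 : EuclideanSpace ℝ (Fin 3)) ((Ns i : ℝ) + 2),
      dist (U s x) (V s x) < ηs i := fun s hs x hx => by
    obtain ⟨hs', hx'⟩ := slab_mono hNi hs hx
    exact (hclose s hs' x hx').trans_le hηi
  have hmid := hJs i U V hU1 hU2 hU3 hU4 hV1 hV2 hV3 hV4 hclose_i x hx
  -- time-Lipschitz on both profiles
  have hwU : ∀ t < 0, IsWeaklyDivFree (U t) := fun t ht' =>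
    (PoloidalWindowDoorPoloidalWindowRigidityWindow.isTypeIAncientMild_of_class hU1 hU2 hU3 hU4).isWeaklyDivFree ht'
  have hwV : ∀ t < 0, IsWeaklyDivFree (V t) := fun t ht' =>
    (PoloidalWindowDoorPoloidalWindowRigidityWindow.isTypeIAncientMild_of_class hV1 hV2 hV3 hV4).isWeaklyDivFree ht'
  have hLU := hL hU2 hwU hU3 hU1 (ti i) (hwin _ (hti_mem i)) t (hwin t ht) x
  have hLV := hL hV2 hwV hV3 hV1 (ti i) (hwin _ (hti_mem i)) t (hwin t ht) x
  have hLt : L * |t - ti i| ≤ ε / 3 := (mul_le_mul_of_nonneg_left hti_close hL0).trans hLδ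
  calc ‖iteratedFDeriv ℝ k (U t) x - iteratedFDeriv ℝ k (V t) x‖
      = ‖(iteratedFDeriv ℝ k (U t) x - iteratedFDeriv ℝ k (U (ti i)) x) + (iteratedFDeriv ℝ k (U (ti i)) x - iteratedFDeriv ℝ k (V (ti i)) x) +
          (iteratedFDeriv ℝ k (V (ti i)) x - iteratedFDeriv ℝ k (V t) x)‖ := by congr 1; abel
    _ ≤ ‖iteratedFDeriv ℝ k (U t) x - iteratedFDeriv ℝ k (U (ti i)) x‖ + ‖iteratedFDeriv ℝ k (U (ti i)) x - iteratedFDeriv ℝ k (V (ti i)) x‖ +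
          ‖iteratedFDeriv ℝ k (V (ti i)) x - iteratedFDeriv ℝ k (V t) x‖ := norm_add₃_le
    _ < ε / 3 + ε / 3 + ε / 3 := by
        have hA : ‖iteratedFDeriv ℝ k (U t) x - iteratedFDeriv ℝ k (U (ti i)) x‖ ≤ ε / 3 := hLU.trans hLt
        have hC : ‖iteratedFDeriv ℝ k (V (ti i)) x - iteratedFDeriv ℝ k (V t) x‖ ≤ ε / 3 := by
          rw [← norm_neg, neg_sub]; exact hLV.trans hLt
        linarith [hmid]
    _ = ε := by ring

/-- **Recurrence controls all jets, uniformly on a time window.**  See the module docstring. -/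
theorem recurrent_jets_window {C : ℝ} {U : ℝ → EuclideanSpace ℝ (Fin 3) → EuclideanSpace ℝ (Fin 3)} {Γ : ℝ → EuclideanSpace ℝ (Fin 3)}
    (hrate : HasTypeITimeDecay C U) (hcont : ContinuousOn (uncurry U) (Iio (0 : ℝ) ×ˢ univ))
    (hmild : ∀ s t : ℝ, s < t → t < 0 → ∀ x, U t x = heatExtension (U s) (t - s) x - oseenDuhamel 1 s U U t x)
    (hdiv : ∀ t < 0, VectorCalculus.IsDivFree (U t))
    (hrec : (∀ ε : ℝ, 0 < ε → ∀ n : ℕ, ∃ L : ℝ, 0 < L ∧ ∀ a : ℝ, ∃ σ' ∈ Icc a (a + L),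
        (∀ t ∈ Icc (-((n : ℝ) + 2)) (-((n : ℝ) + 2)⁻¹), ∀ x ∈ closedBall (0 : EuclideanSpace ℝ (Fin 3)) ((n : ℝ) + 2),
          dist (U t (x + Γ σ')) (U t x) < ε) ∧
        (∀ s ∈ Icc (-((n : ℝ) + 2)) ((n : ℝ) + 2), dist (Γ (s + σ') - Γ σ') (Γ s) < ε)))
    (k : ℕ) {a b : ℝ} (hab : a ≤ b) (hb : b < 0) (R ε : ℝ) (hε : 0 < ε) (n : ℕ) :
    ∃ L : ℝ, 0 < L ∧ ∀ a' : ℝ, ∃ σ' ∈ Icc a' (a' + L),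
      (∀ s ∈ Icc (-((n : ℝ) + 2)) (-((n : ℝ) + 2)⁻¹), ∀ x ∈ closedBall (0 : EuclideanSpace ℝ (Fin 3)) ((n : ℝ) + 2), dist (U s (x + Γ σ')) (U s x) < ε) ∧
      (∀ s ∈ Icc (-((n : ℝ) + 2)) ((n : ℝ) + 2), dist (Γ (s + σ') - Γ σ') (Γ s) < ε) ∧
      (∀ t ∈ Icc a b, ∀ x ∈ closedBall (0 : EuclideanSpace ℝ (Fin 3)) R, ‖iteratedFDeriv ℝ k (U t) (x + Γ σ') - iteratedFDeriv ℝ k (U t) x‖ < ε) := by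
  obtain ⟨N, η, hη, hJ⟩ := jet_closeness_of_slab_closeness_window C k hab hb R ε hε
  obtain ⟨L, hL, hwin⟩ := hrec (min η ε) (lt_min hη hε) (max N n)
  refine ⟨L, hL, fun a' => ?_⟩
  obtain ⟨σ', hσ', h1, h2⟩ := hwin a'
  have hnN : n ≤ max N n := le_max_right _ _
  have hNN : N ≤ max N n := le_max_left _ _
  refine ⟨σ', hσ', fun s hs x hx => ?_, fun s hs => ?_, fun t ht x hx => ?_⟩
  · obtain ⟨hs', hx'⟩ := slab_mono hnN hs hx
    exact (h1 s hs' x hx').trans_le (min_le_right _ _)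
  · have hmn : (n : ℝ) + 2 ≤ ((max N n : ℕ) : ℝ) + 2 := by have := Nat.cast_le (α := ℝ).2 hnN; linarith
    exact (h2 s ⟨by linarith [hs.1], hs.2.trans hmn⟩).trans_le (min_le_right _ _)
  · obtain ⟨hrate', hcont', hmild'⟩ := PoloidalWindowDoorPoloidalWindowRigidityLeafUniformPins.class_translate hrate hcont hmild (Γ σ')
    have hdiv' : ∀ t < 0, VectorCalculus.IsDivFree ((fun t x => U t (x + Γ σ')) t) := fun t ht' => isDivFree_translate_arg (hdiv t ht') (Γ σ')
    have hclose : ∀ s ∈ Icc (-((N : ℝ) + 2)) (-((N : ℝ) + 2)⁻¹), ∀ x ∈ closedBall (0 : EuclideanSpace ℝ (Fin 3)) ((N : ℝ) + 2),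
        dist ((fun t x => U t (x + Γ σ')) s x) (U s x) < η := fun s hs x hx => by
      obtain ⟨hs', hx'⟩ := slab_mono hNN hs hx
      exact (h1 s hs' x hx').trans_le (min_le_left _ _)
    have h := hJ (fun t x => U t (x + Γ σ')) U hrate' hcont' hmild' hdiv' hrate hcont hmild hdiv hclose t ht x hx
    have e : iteratedFDeriv ℝ k ((fun t x => U t (x + Γ σ')) t) x = iteratedFDeriv ℝ k (U t) (x + Γ σ') :=
      iteratedFDeriv_comp_add_right k (Γ σ') x
    rw [e] at h
    exact h

end Summit.NavierStokesRegularity.NavierStokesRegularity.Theorems.PoloidalWindowDoorLrcModEntireRidgeWebRecurrentJetsWindow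

end
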